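import Summits.ABC.IUTFork.Cor312LicenceTripleHullCellRefuteM
import HarnessLib

/-!
# M LINE: the hull-level clause S_H at the summand-route M-level sharp setting of an abc-triple datum's OWN ideles REFUTED from failing hull cells
# at a tame pole, for EVERY member of the (sharp) kernel class of local types — the M books' binder shape of «W:REF-EXACT-M-TWIN» (file 2)

PROOF-ONLY file (D-0012; 0 definitions, 0 `Prop` facts, no instance) of the abc-iut cell — D-0079 RESCUE sub-cell R-W «WINDOW Θ-SIDE INEQUALITY»,
seat abc-iut-W-neg-1 (gen 6), row «W:REF-EXACT-M-TWIN» (file 1 = `Cor312LicenceTripleHullCellRefuteM`: `WRowM.not_licence_triple_of_hullCells_tameSharp`).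
TAKES NO SIDE on [IUTchIII] Cor. 3.12 (S. Mochizuki, *Inter-universal Teichmüller theory III*, Cor. 3.12 p. 173–174; Step (xi-f) p. 184) or on any
author; «refuted as typed» ≠ «refuted in print».

THIS FILE turns file 1's `¬ Licence` at abc-iut-s2-p8's own-ideles M setting into the per-datum object of the M books of record — the binder `hSHw`
of abc-iut-C-cert-3's `Conditional.abc_of_SH_v11M_window` / `…_szpiroBadAll` (p445989 / p453767): `¬ Cor312Vol.PilotKummerCompatHull
(LatticeSituation.ofShells (logShellsOfInitialDH T.D (analyticLogvVal T.K)) …) (settingPrVolSharpM T.D … (tOfIdeleData T.D (ideleDataOf T.D T.isVolumeInputOf)) …)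
… qK` for EVERY choice of the free context binders and Kummer datum (PINNED reading, the q-pin holds by `rfl`, so S_H is the licence by abc-iut-c312-1's
`licence_of_pilotKummerCompatHull`) — the statement shape of abc-iut-W-ref-1's `GenuineM.not_pilotKummerCompatHull_ratPoint_of_tame_robust`
(`AbcOfSGenuineMTameRobust`) and of abc-iut-W-num-6's `GenuineM.not_pilotKummerCompatHull_triple_of_radCerts`, with THIS seat's class-robust hull-cell
hypothesis `hcell` (the one of the K engine `GenuineK.not_pilotKummerCompatHull_chosen_triple_of_hullCells_tameSharp`, p498814, VERBATIM):

* **`GenuineM.not_pilotKummerCompatHull_triple_of_hullCells_tameSharp`** — `a + b = c` an abc triple, `l` any level, `T` a genuine Θ-volume datum at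
  `(ratPoint (a/c), l)`, a finite place `u` of `ℚ` with `p_u = p ∣ abc`, `p ∉ {2, 3, 5, l}`, `v := v_p(abc)`, a label `i + 1 ≤ (l−1)/2`, and for EVERY `A` in
  the sharp kernel class (`A ∣ 30`, `15 ∣ A·v`, `v` even ⇒ `A ∣ 15`, `3 ∣ v ⇒ A ∣ 10`, `5 ∣ v ⇒ A ∣ 6`) a turning point `a₀` of `A·l` with
  `¬ HullCell (A·l) (A·v) (i+1) (⌊A·l/(p−1)⌋+1) (p^{a₀} − a₀·A·l)` ⟹ S_H FAILS at the M-level setting of `T`'s own ideles, every context / Kummer binder.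
  The M twin of `GenuineK.not_pilotKummerCompatHull_chosen_triple_of_hullCells_tameSharp` (and of `…_tame` p496736: its weaker class hypothesis feeds
  this one by ignoring the two Tate clauses). CONSUMERS: the M twins of the K files of `plan/rescue/R-W/M-TWIN-GAP.tsv` (REF-BANDS-EXACT levels and
  bands), which re-use the K files' integer cell lemmas (`RefBand.cells_…`) BY NAME.

READING (neutral; numbers, not adjectives): a sufficient condition for the M books' per-datum S_H object to FAIL at EVERY genuine datum of the class
`(ratPoint (a/c), l)`; admissibility / Szpiro-badness / (P6) / NON-EMPTINESS of the class are NOT claimed; the explicit hypothesis counts of the record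
books are UNCHANGED. HONEST SCOPE: OUR sharp containers (Θ-possible-image set constant in `m`) and Dupuy–Hilado's typed (Ind1)/(Ind2); the per-label licence
is a STRONGER-THAN-PRINT set-level reading of Step (xi-f) (ADJUDICATION-SPEC §2 (G1′)); nothing about the printed GLOBAL inequality, the number-level
`Cor22.Cor312AtDatum` or any author's intended hull; typed ≠ proved; instantiated ≠ endorsed; no abc claim.
[cite: Mochizuki2012, IUTchI Def. 3.1 (b),(c),(e) pp. 61–62, Ex. 3.2 (iv) p. 67; IUTchIII Cor. 3.12 Step (xi-f) p. 184; IUTchIV Prop. 1.1 p. 9, Prop. 1.2 (i)(ii) p. 10, Cor. 2.2 (ii) proof (P5) p. 46]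
[cite: DupuyHilado2025, §3.3, §3.4, §3.9, §4.9, §4.12] [cite: NeukirchANT1999, Ch. II (5.5)] [cite: SerreLocalFields1979, Ch. III §6 Prop. 13]
[claim: Mochizuki2012, status: disputed] for every IUT sentence.
-/

noncomputable section

open Set Function Metric NumberField IsDedekindDomain

namespace Summit.ABC.IUTFork.Conditional

open Thm311 Thm311.Real Cor312 Cor312Vol Cor312Prov Literature.IUT.LogThetaLattice Literature.IUT.LogVolume
  Literature.IUT.HodgeTheaters Literature.IUT.LogVolume.ThetaData Literature.IUT.LogVolume.Cor22
open Literature.NumberTheory.NumberFields Literature.NumberTheory.GaloisRepresentations.Ultrametric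
open Literature.NumberTheory.DiophantineGeometry Literature.NumberTheory.DiophantineGeometry.GenEll Summit.ABC.ABC.Theorems
open Summit.ABC.IUTFork.Repair.RH.HullThresholdExact

/-! ## The M books' per-datum S_H object refuted from class-robust failing hull cells -/

/-- **M LINE: S_H FAILS AT THE OWN-IDELES M-LEVEL SETTING OF AN abc-TRIPLE DATUM WHEN R-H ROW 4's COLUMN FAILS AT A TAME POLE FOR EVERY MEMBER OF
THE SHARP KERNEL CLASS OF LOCAL TYPES.** `a + b = c` an abc triple, `l` any level, `T` a genuine Θ-volume datum at `(ratPoint (a/c), l)`; a finite place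
`u` of `ℚ` with `p_u = p ∣ abc`, `p ∉ {2, 3, 5, l}`, `v := v_p(abc)`; a label `i + 1 ≤ (l−1)/2`; and for EVERY `A` with `A ∣ 30`, `15 ∣ A·v`, (`v` even ⇒
`A ∣ 15`), (`3 ∣ v` ⇒ `A ∣ 10`), (`5 ∣ v` ⇒ `A ∣ 6`) a turning point `a₀` of `A·l` with `¬ HullCell (A·l) (A·v) (i+1) (⌊A·l/(p−1)⌋+1) (p^{a₀} − a₀·A·l)`.
THEN the hull-level clause S_H at the summand-route M-level sharp setting of `T`'s OWN read-off ideles (PINNED reading) FAILS for every choice of the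
free context binders and Kummer datum: the q-pin holds by `rfl`, so S_H is the licence (abc-iut-c312-1's `licence_of_pilotKummerCompatHull`), which
file 1's `WRowM.not_licence_triple_of_hullCells_tameSharp` refutes at `r := ideleDataOf T.D T.isVolumeInputOf`. The M twin of this seat's K engine
`GenuineK.not_pilotKummerCompatHull_chosen_triple_of_hullCells_tameSharp` (p498814). Sharp reading; refuted-as-typed only.
[cite: Mochizuki2012, IUTchI Def. 3.1 (e) p. 62, Ex. 3.2 (iv) p. 67; IUTchIII Cor. 3.12 Step (xi-f) p. 184; IUTchIV Prop. 1.2 (i)(ii) p. 10, Cor. 2.2 (ii) proof (P5) p. 46]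
[cite: DupuyHilado2025, §3.3, §3.4, §4.9, §4.12] [claim: Mochizuki2012, status: disputed] -/
theorem GenuineM.not_pilotKummerCompatHull_triple_of_hullCells_tameSharp {a b c l : ℕ} (habc : IsABCTriple a b c)
    (T : Cor22.ThetaVolumeDatumAt (ratPoint ((a : ℚ) / c)) l) (u : FinitePlace ℚ) (p : ℕ) (hu : ratChar u = p)
    (hp2 : p ≠ 2) (hp3 : p ≠ 3) (hp5 : p ≠ 5) (hpl : p ≠ l) (hpabc : p ∣ a * b * c) {v : ℕ} (hv : (a * b * c).factorization p = v)
    {i : ℕ} (hi : i + 1 ≤ (l - 1) / 2)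
    (hcell : ∀ A : ℕ, A ∣ 30 → 15 ∣ A * v → (Even v → A ∣ 15) → (3 ∣ v → A ∣ 10) → (5 ∣ v → A ∣ 6) →
      ∃ a₀ : ℕ, (∀ s : ℕ, s < a₀ → (1 : ℤ) * (p : ℤ) ^ s * ((p : ℤ) - 1) < ((A * l : ℕ) : ℤ)) ∧
        ((A * l : ℕ) : ℤ) ≤ 1 * (p : ℤ) ^ a₀ * ((p : ℤ) - 1) ∧
        ¬ HullCell ((A * l : ℕ) : ℤ) ((A * v : ℕ) : ℤ) ((i : ℤ) + 1) (((A * l) / (p - 1) + 1 : ℕ) : ℤ)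
          ((p : ℤ) ^ a₀ - (a₀ : ℤ) * ((A * l : ℕ) : ℤ))) :
    letI := T.instFieldF; letI := T.instNumberFieldF; letI := T.instAlgebraF; letI := T.instFieldK
    letI := T.instNumberFieldK; letI := T.instAlgebraK; letI := T.instFieldFbar; letI := T.instAlgebraFbar
    letI := T.instAlgebraKFbar; letI := T.instIsElliptic
    ∀ (M : Type) [Field M] [NumberField M]
      (archPk : ∀ (j : (thetaIndexOfInitial T.D).Label) (vQ : (thetaIndexOfInitial T.D).VQ),
        Set ((logShellsOfInitialDH T.D (analyticLogvVal T.K)).Packet j vQ))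
      (archSub : ∀ (j : (thetaIndexOfInitial T.D).Label) (v : (thetaIndexOfInitial T.D).V),
        Set ((logShellsOfInitialDH T.D (analyticLogvVal T.K)).Packet j ((thetaIndexOfInitial T.D).over v)))
      (Ψ : ℤ → ∀ v : (thetaIndexOfInitial T.D).V, v ∈ (thetaIndexOfInitial T.D).Vbad →
        Set ((logShellsOfInitialDH T.D (analyticLogvVal T.K)).StarPacket v))
      (act : ℤ → ∀ v : (thetaIndexOfInitial T.D).V, v ∈ (thetaIndexOfInitial T.D).Vbad →
        (logShellsOfInitialDH T.D (analyticLogvVal T.K)).StarPacket v →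
          Module.End ℚ ((logShellsOfInitialDH T.D (analyticLogvVal T.K)).StarPacket v))
      (Mmod : ℤ → ∀ j : (thetaIndexOfInitial T.D).LabelStar, Set ((logShellsOfInitialDH T.D (analyticLogvVal T.K)).GlobalPacket j.1))
      (region : ℤ → ∀ j : (thetaIndexOfInitial T.D).LabelStar, FinDivisor M → ∀ vQ : (thetaIndexOfInitial T.D).VQ,
        Set ((logShellsOfInitialDH T.D (analyticLogvVal T.K)).Packet j.1 vQ))
      (frobAdm : ℤ → ℤ → ∀ (j : (thetaIndexOfInitial T.D).Label) (vQ : (thetaIndexOfInitial T.D).VQ),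
        Set ((logShellsOfInitialDH T.D (analyticLogvVal T.K)).Packet j vQ) → Prop)
      (frobLogvol : ℤ → ℤ → ∀ (j : (thetaIndexOfInitial T.D).Label) (vQ : (thetaIndexOfInitial T.D).VQ),
        Set ((logShellsOfInitialDH T.D (analyticLogvVal T.K)).Packet j vQ) → ℝ)
      (frobΨ : ℤ → ℤ → ∀ v : (thetaIndexOfInitial T.D).V, v ∈ (thetaIndexOfInitial T.D).Vbad →
        Set ((logShellsOfInitialDH T.D (analyticLogvVal T.K)).StarPacket v))
      (frobMmod : ℤ → ℤ → ∀ j : (thetaIndexOfInitial T.D).LabelStar, Set ((logShellsOfInitialDH T.D (analyticLogvVal T.K)).GlobalPacket j.1))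
      (unitImage : ℤ → ℤ → ℕ → ∀ (j : (thetaIndexOfInitial T.D).Label) (vQ : (thetaIndexOfInitial T.D).VQ),
        Set ((logShellsOfInitialDH T.D (analyticLogvVal T.K)).Packet j vQ))
      (ballImage : ℤ → ℤ → ∀ (j : (thetaIndexOfInitial T.D).Label) (vQ : (thetaIndexOfInitial T.D).VQ),
        Set ((logShellsOfInitialDH T.D (analyticLogvVal T.K)).Packet j vQ))
      (thetaDiv : ℤ → ℤ → LgpDivisor M (thetaIndexOfInitial T.D).lstar)
      (n : ℤ) {HT : Type} {LogLink : HT → HT → Type} {IsFull : ∀ {s t : HT}, LogLink s t → Prop}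
      (lat : LGPGaussianLogThetaLattice LogLink IsFull)
      {Frd : Type} {IsoF : Frd → Frd → Type} {Ob : Frd → Type} {realify : Frd → Frd} {Strip : Type}
      {IsoS : Strip → Strip → Type} {Mv : ∀ v : (thetaIndexOfInitial T.D).V, v ∈ (thetaIndexOfInitial T.D).Vbad → Type}
      [∀ v h, Monoid (Mv v h)]
      (sig : GlobalLGPFrobenioidSignature (thetaIndexOfInitial T.D).lstar (thetaIndexOfInitial T.D).V
        (· ∈ (thetaIndexOfInitial T.D).Vbad) Frd IsoF Ob realify Strip IsoS Mv)
      (split : SplittingMonoids Mv) {ObΔ : Type} {N : ∀ v : (thetaIndexOfInitial T.D).V, v ∈ (thetaIndexOfInitial T.D).Vbad → Type}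
      [∀ v h, Monoid (N v h)] (qData : QPilotData ObΔ N)
      (qK : ∀ v : (thetaIndexOfInitial T.D).V, v ∈ (thetaIndexOfInitial T.D).Vbad →
        Set ((logShellsOfInitialDH T.D (analyticLogvVal T.K)).StarPacket v)),
      ¬ Cor312Vol.PilotKummerCompatHull
        (LatticeSituation.ofShells (logShellsOfInitialDH T.D (analyticLogvVal T.K)) M archPk archSub
          (summandPiecesPrM T.D (logvAnalyticVal_analyticLogvVal (K := T.K))).Adm (summandPiecesPrM T.D (logvAnalyticVal_analyticLogvVal (K := T.K))).logvol Ψ act Mmod region frobAdm frobLogvol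
          frobΨ frobMmod unitImage ballImage thetaDiv)
        (settingPrVolSharpM T.D (logvAnalyticVal_analyticLogvVal (K := T.K)) (tOfIdeleData T.D (ideleDataOf T.D T.isVolumeInputOf))
          (fun u x => tqM T.D (ratChar u) u (natCast_ratChar_mem u) (ideleDataOf T.D T.isVolumeInputOf) x) M archPk archSub Ψ act Mmod region n lat sig split qData
          (fun u x => tqM_ne_zero T.D (ratChar u) u (natCast_ratChar_mem u) (ideleDataOf T.D T.isVolumeInputOf) x)
          (GenuineM.finite_ratPlaces_under_S T.D).toFinset
          (fun u x hu => norm_tqM_eq_one_of_not_mem T.D (ratChar u) u (natCast_ratChar_mem u) (ideleDataOf T.D T.isVolumeInputOf) x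
            fun hx => hu ((Set.Finite.mem_toFinset _).mpr ⟨x, hx⟩)))
        (fun _ => Cor312.Setting.qRegion
          (settingPrVolSharpM T.D (logvAnalyticVal_analyticLogvVal (K := T.K)) (tOfIdeleData T.D (ideleDataOf T.D T.isVolumeInputOf))
          (fun u x => tqM T.D (ratChar u) u (natCast_ratChar_mem u) (ideleDataOf T.D T.isVolumeInputOf) x) M archPk archSub Ψ act Mmod region n lat sig split qData
          (fun u x => tqM_ne_zero T.D (ratChar u) u (natCast_ratChar_mem u) (ideleDataOf T.D T.isVolumeInputOf) x)
          (GenuineM.finite_ratPlaces_under_S T.D).toFinset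
          (fun u x hu => norm_tqM_eq_one_of_not_mem T.D (ratChar u) u (natCast_ratChar_mem u) (ideleDataOf T.D T.isVolumeInputOf) x
            fun hx => hu ((Set.Finite.mem_toFinset _).mpr ⟨x, hx⟩)))) qK := by
  classical
  letI := T.instFieldF; letI := T.instNumberFieldF; letI := T.instAlgebraF; letI := T.instFieldK
  letI := T.instNumberFieldK; letI := T.instAlgebraK; letI := T.instFieldFbar; letI := T.instAlgebraFbar
  letI := T.instAlgebraKFbar; letI := T.instIsElliptic
  intro M _ _ archPk archSub Ψ act Mmod region frobAdm frobLogvol frobΨ frobMmod unitImage ballImage thetaDiv n HT LogLink IsFull lat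
    Frd IsoF Ob realify Strip IsoS Mv _ sig split ObΔ N _ qData qK hSH
  exact WRowM.not_licence_triple_of_hullCells_tameSharp habc T u p hu hp2 hp3 hp5 hpl hpabc hv hi hcell
    (logvAnalyticVal_analyticLogvVal (K := T.K)) (ideleDataOf T.D T.isVolumeInputOf) M archPk archSub Ψ act Mmod region n lat sig split qData
    (fun u x => tqM_ne_zero T.D (ratChar u) u (natCast_ratChar_mem u) (ideleDataOf T.D T.isVolumeInputOf) x)
    (GenuineM.finite_ratPlaces_under_S T.D).toFinset
    (fun u x hu => norm_tqM_eq_one_of_not_mem T.D (ratChar u) u (natCast_ratChar_mem u) (ideleDataOf T.D T.isVolumeInputOf) x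
      fun hx => hu ((Set.Finite.mem_toFinset _).mpr ⟨x, hx⟩))
    (licence_of_pilotKummerCompatHull
      (LatticeSituation.ofShells (logShellsOfInitialDH T.D (analyticLogvVal T.K)) M archPk archSub
        (summandPiecesPrM T.D (logvAnalyticVal_analyticLogvVal (K := T.K))).Adm
        (summandPiecesPrM T.D (logvAnalyticVal_analyticLogvVal (K := T.K))).logvol Ψ act Mmod region frobAdm frobLogvol
        frobΨ frobMmod unitImage ballImage thetaDiv)
      _ _ qK (fun _ _ => rfl) hSH)

end Summit.ABC.IUTFork.Conditional

end
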